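import Mathlib

/-!
# Block-triangular rank inequality for the layered homed-block certificate (DEQ-A07D)

HONEST FRAMING: instance-level adjudication of specific advantage claims; no claim about
BQP vs BPP or the summit.

Context (cell pub-qadeq, claim A-07 = Berry et al., "Analyzing prospects for quantum advantage in
topological data analysis", arXiv:2209.13581v3 / PRX Quantum 5, 010319: §4.1, the perturbed
complete-`k`-partite family `G = K(m,k) - D`; residual O2′ of OPEN-1, flagship sizes `(m,k) = (16,16)`).
DEQ-A07B.md reduced `β_{k-1}(Cl(G))` to `N(G,R) - rank Λ_R` for an explicit 0/1 matrix `Λ_R` (its Lean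
receipt is `MultipartiteLineRank.lean` in this directory).  DEQ-A07D.md (unit pub-qadeq-deq-1, Theorem A)
certifies `rank Λ_R` from below by a sum of ranks of finitely many diagonal blocks `Λ_R[R_u, C_u]` indexed by
"homed labels" `u`, ordered by (layer, inner dimension), after showing that the rows owning the block's
columns lie in the block itself or in blocks that come EARLIER in the order (DEQ-A07D Lemma 2), and from
above by dependency vectors whose supports leave a block only towards LATER blocks (Lemma 3).  Both steps
are the following `[folklore]` fact applied along the order: the rank of a block upper-triangular matrix is
at least the sum of the ranks of its diagonal blocks.  Mathlib has the `fromBlocks` API but not this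
inequality; it is proved here from rank–nullity for the second-block projection restricted to the range.
No named fact, no axiom beyond the standard ones, no `def`, no `sorry`.
-/

namespace Summit.QuantumAdvantage.Dequantization.BlockTriangularRank

open Matrix


variable {K : Type*} [Field K]
variable {m n o p : Type*} [Fintype o] [Fintype p]

/-- For a block upper-triangular matrix `[[A, B], [0, D]]` over a field,
`rank A + rank D ≤ rank [[A, B], [0, D]]`. -/
theorem rank_add_rank_le_rank_fromBlocks_zero₂₁
    (A : Matrix m o K) (B : Matrix m p K) (D : Matrix n p K) :
    A.rank + D.rank ≤ (Matrix.fromBlocks A B 0 D).rank := by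
  classical
  -- the three linear maps
  set M : Matrix (m ⊕ n) (o ⊕ p) K := Matrix.fromBlocks A B 0 D with hM
  let f : ((o ⊕ p) → K) →ₗ[K] ((m ⊕ n) → K) := M.mulVecLin
  -- projection onto the second block of coordinates
  let π₂ : ((m ⊕ n) → K) →ₗ[K] (n → K) :=
    { toFun := fun v => fun i => v (Sum.inr i)
      map_add' := by intro v w; rfl
      map_smul' := by intro c v; rfl }
  -- Step 1: range (π₂ ∘ f) ⊇ range D.mulVecLin, hence finrank ≥ rank D
  have h1 : LinearMap.range D.mulVecLin ≤ LinearMap.range (π₂.comp f) := by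
    rintro w ⟨y, rfl⟩
    refine ⟨Sum.elim 0 y, ?_⟩
    ext i
    simp [π₂, f, hM, Matrix.fromBlocks_mulVec, LinearMap.comp_apply]
  -- Step 2: the vectors (A x, 0) lie in range f ∩ ker π₂
  let g : (o → K) →ₗ[K] ((m ⊕ n) → K) :=
    { toFun := fun x => Sum.elim (A *ᵥ x) 0
      map_add' := by
        intro x y; ext i; rcases i with i | i <;> simp [Matrix.mulVec_add]
      map_smul' := by
        intro c x; ext i; rcases i with i | i <;> simp [Matrix.mulVec_smul] }
  have hg_range : LinearMap.range g ≤ LinearMap.range f ⊓ LinearMap.ker π₂ := by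
    rintro v ⟨x, rfl⟩
    constructor
    · refine ⟨Sum.elim x 0, ?_⟩
      ext i
      rcases i with i | i <;> simp [f, g, hM, Matrix.fromBlocks_mulVec]
    · simp [π₂, g, LinearMap.mem_ker]
      rfl
  -- rank of g equals rank A: g = (inl-embedding) ∘ A.mulVecLin with injective embedding
  have hg_rank : Module.finrank K (LinearMap.range g) = A.rank := by
    let ι : (m → K) →ₗ[K] ((m ⊕ n) → K) :=
      { toFun := fun u => Sum.elim u 0
        map_add' := by intro u v; ext i; rcases i with i | i <;> simp
        map_smul' := by intro c u; ext i; rcases i with i | i <;> simp }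
    have hι : Function.Injective ι := by
      intro u v huv
      ext i
      have := congrArg (fun w => w (Sum.inl i)) huv
      simpa [ι] using this
    have hcomp : g = ι.comp A.mulVecLin := by
      apply LinearMap.ext; intro x; rfl
    rw [hcomp, LinearMap.range_comp, Matrix.rank]
    exact (LinearEquiv.finrank_eq (Submodule.equivMapOfInjective ι hι (LinearMap.range A.mulVecLin))).symm
  -- Step 3: rank-nullity for π₂ restricted to range f
  have key := LinearMap.finrank_range_add_finrank_ker (π₂.domRestrict (LinearMap.range f))
  -- range of the restriction = range (π₂ ∘ f)
  have hr : LinearMap.range (π₂.domRestrict (LinearMap.range f)) = LinearMap.range (π₂.comp f) := by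
    apply le_antisymm
    · rintro w ⟨⟨v, ⟨x, rfl⟩⟩, rfl⟩; exact ⟨x, rfl⟩
    · rintro w ⟨x, rfl⟩; exact ⟨⟨f x, ⟨x, rfl⟩⟩, rfl⟩
  -- kernel of the restriction contains (a copy of) range g
  have hk : Module.finrank K (LinearMap.range g) ≤
      Module.finrank K (LinearMap.ker (π₂.domRestrict (LinearMap.range f))) := by
    -- map range g into the kernel injectively via Submodule.inclusion-like map
    let j : LinearMap.range g →ₗ[K] LinearMap.ker (π₂.domRestrict (LinearMap.range f)) :=
      { toFun := fun v => ⟨⟨v.1, (hg_range v.2).1⟩, by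
          simp [LinearMap.mem_ker, LinearMap.domRestrict_apply]
          exact (hg_range v.2).2⟩
        map_add' := by intro v w; rfl
        map_smul' := by intro c v; rfl }
    have hj : Function.Injective j := by
      intro v w hvw
      have := congrArg (fun z => ((z : LinearMap.ker _) : LinearMap.range f).1) hvw
      exact Subtype.ext this
    exact LinearMap.finrank_le_finrank_of_injective hj
  have hD : D.rank ≤ Module.finrank K (LinearMap.range (π₂.domRestrict (LinearMap.range f))) := by
    rw [hr, Matrix.rank]
    exact Submodule.finrank_mono h1
  have hMrank : M.rank = Module.finrank K (LinearMap.range f) := rfl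
  rw [hMrank, ← key]
  rw [hg_rank] at hk
  omega

end Summit.QuantumAdvantage.Dequantization.BlockTriangularRank
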